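import Summits.RiemannHypothesis.RiemannHypothesis.Theorems.WeilFormatCCinfExactTables
import HarnessLib

/-!
# Format C, design C∞ (E2 data side): stage L — exact-coefficient linear combinations of claimed tables

Route context: Fourier–Galerkin / Schur-complement certificates of Weil positivity on a window ("format C", C∞ door;
cell memo `run/shared/lean/pub/rh-explicit/rh-explicit-weil-2/gen15/E2-PLAN-v2.md` §6 and the gen16 layout of record,
HOME STATUS 2026-08-25 «weil-2 gen16 STATUS 0/1»; supporting stmt-RiemannHypothesis-0098; seat rh-explicit-weil-2).

The LINEAR stages of the C∞ certificate matrix (resolved middle columns minus the free map, family-matrix rows,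
`Hmid·A`, and the final assembly of `S` from its claimed pieces) have the shape
`out(p,t) = Σ_{s<K} Σ_{q<nq_s} P_s(p,q)·Q_s(t,q)` over PAIRS of tables read row-wise (`P_s` by the output row `p`, `Q_s` by
the output column `t`), where in each pair ONE side is EXACT (the generator's rationals: identities, `Λ1`, `Λ2`, profile
coefficients, Hankel midpoints, `θ`-factors — integer tables at scale `2^cC`) and the OTHER is CLAIMED (`TabNear` at scale
`2^cx`): pairs `s < K₁` have `P_s` exact / `Q_s` claimed, pairs `K₁ ≤ s < K` have `P_s` claimed / `Q_s` exact.  Generic: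

* input: for `s < K₁`: `P s p q = PZ_s[p][q]/2^cC` and `CinfExact.TabNear (Q s) W (nq s) cx (ρ s) (QZ s)`; for `K₁ ≤ s < K`:
  `CinfExact.TabNear (P s) n (nq s) cx (ρ s) (PZ s)` and `Q s t q = QZ_s[t][q]/2^cC`;
* kernel work: `CinfStageL.rowL PZ QZ K W p` = `(Σ_s dotZ2 PZ_s[p] QZ_s[t])_{t<W}` exactly (GMP), compared with the claim `OZ`
  at scale `cO = cC + cx − k` in row bands (`checkLrows`, glued by `LRows.zero/extend`), plus scalar checks (shapes; row
  masses of the EXACT sides `Σ_q |PZ_s[p][q]| ≤ M s` (`s < K₁`), `Σ_q |QZ_s[t][q]| ≤ M s` (`s ≥ K₁`); budget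
  `Σ_s ρ_s·M_s + 2^k ≤ ρO·2^k`);
* output: `CinfExact.TabNear (CinfStageL.LgenR P Q K nq) n W cO ρO OZ` (`stageL_tabNear`), the analytic radius carried by
  `CinfExact.abs_sum_mul_sub_le_lin` / `…_exact_right`.

Standard axioms; no RH claim.
-/

set_option autoImplicit false
-- `Summit.RiemannHypothesis.RiemannHypothesis.…` is the layout-mandated namespace (summit = problem name).
set_option linter.dupNamespace false

open Finset

namespace Summit.RiemannHypothesis.RiemannHypothesis.Theorems.WeilFormatC

open Literature.NumberTheory.LFunctions (PsdDyadic.getMZ)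

namespace CinfStageL

/-! ## The real object -/

/-- `out(p,t) = Σ_{s<K} Σ_{q<nq s} P s p q · Q s t q`. -/
noncomputable def LgenR (P Q : ℕ → ℕ → ℕ → ℝ) (K : ℕ) (nq : ℕ → ℕ) (p t : ℕ) : ℝ :=
  ∑ s ∈ range K, ∑ q ∈ range (nq s), P s p q * Q s t q

/-! ## The integer computation and the checks -/

/-- `Σ_{s<K} dotZ2 PZ_s[p] QZ_s[t]` (structural in `K`). -/
def sumPairs (PZ QZ : ℕ → List (List ℤ)) (p t : ℕ) : ℕ → ℤ
  | 0 => 0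
  | s + 1 => sumPairs PZ QZ p t s + CinfExact.dotZ2 ((PZ s).getD p []) ((QZ s).getD t [])

/-- Row `p` of the exact integer output (scale `2^(cC+cx)`). -/
def rowL (PZ QZ : ℕ → List (List ℤ)) (K W p : ℕ) : List ℤ :=
  (List.range W).map fun t ↦ sumPairs PZ QZ p t K

/-- `|x − y·2^k| ≤ 2^k` entrywise for two integer lists of equal length. -/
def nearShiftL (k : ℕ) : List ℤ → List ℤ → Bool
  | [], [] => true
  | x :: xs, y :: ys => decide (|x - y * 2 ^ k| ≤ 2 ^ k) && nearShiftL k xs ys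
  | _, _ => false

/-- Specification of `nearShiftL`. -/
theorem nearShiftL_spec {k : ℕ} : ∀ {xs ys : List ℤ}, nearShiftL k xs ys = true →
    ys.length = xs.length ∧ ∀ t < xs.length, |xs.getD t 0 - ys.getD t 0 * 2 ^ k| ≤ 2 ^ k
  | [], [], _ => by simp
  | [], _ :: _, h => by simp [nearShiftL] at h
  | _ :: _, [], h => by simp [nearShiftL] at h
  | x :: xs, y :: ys, h => by
      simp only [nearShiftL, Bool.and_eq_true, decide_eq_true_eq] at h
      obtain ⟨hl, hi⟩ := nearShiftL_spec h.2
      refine ⟨by simp [hl], fun t ht ↦ ?_⟩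
      cases t with
      | zero => simpa using h.1
      | succ t => simp only [List.getD_cons_succ]; exact hi t (by simpa using ht)

/-- **Band check**: for `p ∈ [p₀, p₀+kb)`, the claimed row `OZ[p]` is the computed row up to the rounding shift `k`. -/
def checkLrows (PZ QZ : ℕ → List (List ℤ)) (K W k : ℕ) (OZ : List (List ℤ)) (p₀ kb : ℕ) : Bool :=
  CinfExact.allFromTo p₀ kb fun p ↦ nearShiftL k (rowL PZ QZ K W p) (OZ.getD p [])

/-- `LRows … m`: rows below `m` of `OZ` are the computed rows up to the shift. -/
structure LRows (PZ QZ : ℕ → List (List ℤ)) (K W k : ℕ) (OZ : List (List ℤ)) (m : ℕ) : Prop where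
  /-- rounding enclosure of every entry of every row below `m` -/
  out : ∀ p < m, ∀ t < W, |(rowL PZ QZ K W p).getD t 0 - PsdDyadic.getMZ OZ p t * 2 ^ k| ≤ 2 ^ k

/-- Band glue: no rows yet. -/
theorem LRows.zero {PZ QZ : ℕ → List (List ℤ)} {K W k : ℕ} {OZ : List (List ℤ)} : LRows PZ QZ K W k OZ 0 :=
  ⟨fun _ hp ↦ absurd hp (by omega)⟩

/-- **Band glue**: one passing band extends the rows. -/
theorem LRows.extend {PZ QZ : ℕ → List (List ℤ)} {K W k : ℕ} {OZ : List (List ℤ)} {m kb : ℕ}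
    (h1 : LRows PZ QZ K W k OZ m) (h2 : checkLrows PZ QZ K W k OZ m kb = true) : LRows PZ QZ K W k OZ (m + kb) := by
  refine ⟨fun p hp t ht ↦ ?_⟩
  by_cases hpm : p < m
  · exact h1.out p hpm t ht
  · have hb := CinfExact.allFromTo_spec h2 p (by omega) hp
    obtain ⟨-, hnear⟩ := nearShiftL_spec hb
    have hlen : (rowL PZ QZ K W p).length = W := by simp [rowL]
    simpa [PsdDyadic.getMZ] using hnear t (by rw [hlen]; exact ht)

/-- Shapes: for every pair `s < K`, the `P`-rows `p < n` and the `Q`-rows `t < W` have length `nq s`. -/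
def checkLShapes (PZ QZ : ℕ → List (List ℤ)) (K : ℕ) (nq : ℕ → ℕ) (n W : ℕ) : Bool :=
  CinfExact.allFromTo 0 K fun s ↦
    (CinfExact.allFromTo 0 n fun p ↦ decide (((PZ s).getD p []).length = nq s))
      && (CinfExact.allFromTo 0 W fun t ↦ decide (((QZ s).getD t []).length = nq s))

/-- Row masses of ONE table: `Σ_q |Z[p][q]| ≤ M` for all rows `p < m`. -/
def checkMass1 (Z : List (List ℤ)) (m M : ℕ) : Bool :=
  CinfExact.allFromTo 0 m fun p ↦ decide (CinfExact.maxAbsZ [CinfExact.sumZ ((Z.getD p []).map fun z ↦ |z|)] ≤ M)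

/-- Row masses of the EXACT sides: `PZ_s` over `p < n` for `s < K₁`, `QZ_s` over `t < W` for `K₁ ≤ s < K`. -/
def checkLMass (PZ QZ : ℕ → List (List ℤ)) (K₁ K n W : ℕ) (M : ℕ → ℕ) : Bool :=
  (CinfExact.allFromTo 0 K₁ fun s ↦ checkMass1 (PZ s) n (M s))
    && (CinfExact.allFromTo K₁ (K - K₁) fun s ↦ checkMass1 (QZ s) W (M s))

/-- `Σ_{s<K} ρ s · M s` (structural). -/
def budgetSum (ρ M : ℕ → ℕ) : ℕ → ℕ
  | 0 => 0
  | s + 1 => budgetSum ρ M s + ρ s * M s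

/-- **Budget**: `Σ_s ρ_s·M_s + 2^k ≤ ρO·2^k`. -/
def checkLBudget (ρ M : ℕ → ℕ) (K k ρO : ℕ) : Bool :=
  decide (budgetSum ρ M K + 2 ^ k ≤ ρO * 2 ^ k)

/-! ## Soundness -/

/-- `sumZ` of the absolute values is the `ℓ¹` mass. -/
private theorem sumZ_map_abs_eq : ∀ (l : List ℤ) (k : ℕ), l.length = k →
    ((CinfExact.sumZ (l.map fun z ↦ |z|) : ℤ) : ℝ) = ∑ q ∈ range k, |(l.getD q 0 : ℝ)|
  | [], k, h => by subst h; simp [CinfExact.sumZ]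
  | z :: zs, k, h => by
      obtain ⟨k, rfl⟩ : ∃ k', k = k' + 1 := ⟨k - 1, by simp at h; omega⟩
      rw [List.map_cons, CinfExact.sumZ, Finset.sum_range_succ']
      simp only [List.getD_cons_succ, List.getD_cons_zero]
      push_cast
      rw [sumZ_map_abs_eq zs k (by simpa using h)]; ring

/-- `budgetSum` as a sum. -/
private theorem budgetSum_eq (ρ M : ℕ → ℕ) : ∀ K : ℕ, (budgetSum ρ M K : ℝ) = ∑ s ∈ range K, (ρ s : ℝ) * M s
  | 0 => by simp [budgetSum]
  | K + 1 => by rw [budgetSum, Finset.sum_range_succ]; push_cast; rw [budgetSum_eq ρ M K]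

/-- `sumPairs` as a sum. -/
private theorem sumPairs_eq (PZ QZ : ℕ → List (List ℤ)) (p t : ℕ) :
    ∀ K : ℕ, (sumPairs PZ QZ p t K : ℝ)
      = ∑ s ∈ range K, (CinfExact.dotZ2 ((PZ s).getD p []) ((QZ s).getD t []) : ℝ)
  | 0 => by simp [sumPairs]
  | K + 1 => by rw [sumPairs, Finset.sum_range_succ]; push_cast; rw [sumPairs_eq PZ QZ p t K]

/-- Reading `checkMass1`: the `ℓ¹` row masses of the table are at most `M`. -/
private theorem mass_of_checkMass1 {Z : List (List ℤ)} {m M : ℕ} (h : checkMass1 Z m M = true)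
    {p : ℕ} (hp : p < m) {k : ℕ} (hk : (Z.getD p []).length = k) :
    ∑ q ∈ range k, |((Z.getD p []).getD q 0 : ℝ)| ≤ M := by
  have h2 := CinfExact.allFromTo_spec h p (Nat.zero_le _) (by simpa using hp)
  rw [decide_eq_true_eq] at h2
  have h3 : ((CinfExact.sumZ ((Z.getD p []).map fun z ↦ |z|) : ℤ) : ℝ) ≤ M := by
    have h4 := CinfExact.abs_le_maxAbsZ [CinfExact.sumZ ((Z.getD p []).map fun z ↦ |z|)] 0
    simp only [List.getD_cons_zero] at h4
    exact (le_abs_self _).trans (h4.trans (by exact_mod_cast h2))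
  rwa [sumZ_map_abs_eq _ _ hk] at h3

/-- **Stage L soundness.**  Pairs `s < K₁`: `P s` exact (`PZ_s` at scale `cC`), `Q s` claimed (radius `ρ s` at scale `cx`);
pairs `K₁ ≤ s < K`: `P s` claimed, `Q s` exact.  With the shape / mass / budget checks and the row bands, the claimed output
table holds: `TabNear (LgenR P Q K nq) n W cO ρO OZ`, `cO + k = cC + cx`. -/
theorem stageL_tabNear {P Q : ℕ → ℕ → ℕ → ℝ} {K₁ K n W cC cx cO k ρO : ℕ} {nq ρ M : ℕ → ℕ}
    {PZ QZ : ℕ → List (List ℤ)} {OZ : List (List ℤ)} (hK : K₁ ≤ K)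
    (hPex : ∀ s < K₁, ∀ p < n, ∀ q < nq s, P s p q = (PsdDyadic.getMZ (PZ s) p q : ℝ) / 2 ^ cC)
    (hQcl : ∀ s < K₁, CinfExact.TabNear (Q s) W (nq s) cx (ρ s) (QZ s))
    (hPcl : ∀ s, K₁ ≤ s → s < K → CinfExact.TabNear (P s) n (nq s) cx (ρ s) (PZ s))
    (hQex : ∀ s, K₁ ≤ s → s < K → ∀ t < W, ∀ q < nq s, Q s t q = (PsdDyadic.getMZ (QZ s) t q : ℝ) / 2 ^ cC)
    (hshape : checkLShapes PZ QZ K nq n W = true) (hmass : checkLMass PZ QZ K₁ K n W M = true)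
    (hbudget : checkLBudget ρ M K k ρO = true) (hcO : cO + k = cC + cx)
    (hrows : LRows PZ QZ K W k OZ n) :
    CinfExact.TabNear (LgenR P Q K nq) n W cO ρO OZ := by
  -- unpack the Boolean checks
  have hlenP : ∀ s < K, ∀ p < n, ((PZ s).getD p []).length = nq s := fun s hs p hp ↦ by
    have h1 := CinfExact.allFromTo_spec hshape s (Nat.zero_le _) (by simpa using hs)
    rw [Bool.and_eq_true] at h1
    have := CinfExact.allFromTo_spec h1.1 p (Nat.zero_le _) (by simpa using hp)
    rwa [decide_eq_true_eq] at this
  have hlenQ : ∀ s < K, ∀ t < W, ((QZ s).getD t []).length = nq s := fun s hs t ht ↦ by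
    have h1 := CinfExact.allFromTo_spec hshape s (Nat.zero_le _) (by simpa using hs)
    rw [Bool.and_eq_true] at h1
    have := CinfExact.allFromTo_spec h1.2 t (Nat.zero_le _) (by simpa using ht)
    rwa [decide_eq_true_eq] at this
  simp only [checkLMass, Bool.and_eq_true] at hmass
  have hMP : ∀ s < K₁, ∀ p < n, ∑ q ∈ range (nq s), |(((PZ s).getD p []).getD q 0 : ℝ)| ≤ M s := fun s hs p hp ↦
    mass_of_checkMass1 (CinfExact.allFromTo_spec hmass.1 s (Nat.zero_le _) (by simpa using hs)) hp
      (hlenP s (by omega) p hp)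
  have hMQ : ∀ s, K₁ ≤ s → s < K → ∀ t < W, ∑ q ∈ range (nq s), |(((QZ s).getD t []).getD q 0 : ℝ)| ≤ M s :=
    fun s hs1 hs2 t ht ↦
    mass_of_checkMass1 (CinfExact.allFromTo_spec hmass.2 s hs1 (by omega)) ht (hlenQ s hs2 t ht)
  simp only [checkLBudget, decide_eq_true_eq] at hbudget
  have hbud : (budgetSum ρ M K : ℝ) + 2 ^ k ≤ ρO * 2 ^ k := by exact_mod_cast hbudget
  rw [budgetSum_eq] at hbud
  have h2C : (0 : ℝ) < 2 ^ cC := by positivity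
  have h2x : (0 : ℝ) < 2 ^ cx := by positivity
  have h2O : (0 : ℝ) < 2 ^ cO := by positivity
  have hpow : (2 : ℝ) ^ cO * 2 ^ k = 2 ^ cC * 2 ^ cx := by rw [← pow_add, hcO, pow_add]
  refine ⟨fun p hp t ht ↦ ?_⟩
  -- per pair: exact midpoint part and perturbation
  have hpair : ∀ s < K,
      |∑ q ∈ range (nq s), P s p q * Q s t q
          - (CinfExact.dotZ2 ((PZ s).getD p []) ((QZ s).getD t []) : ℝ) / (2 ^ cC * 2 ^ cx)|
        ≤ (ρ s : ℝ) * M s / (2 ^ cC * 2 ^ cx) := by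
    intro s hs
    by_cases hs1 : s < K₁
    · -- P exact, Q claimed
      have hmid : (CinfExact.dotZ2 ((PZ s).getD p []) ((QZ s).getD t []) : ℝ) / (2 ^ cC * 2 ^ cx)
          = ∑ q ∈ range (nq s), P s p q * ((((QZ s).getD t []).getD q 0 : ℝ) / 2 ^ cx) := by
        rw [CinfExact.dotZ2_eq_sum _ _ (nq s) (hlenP s hs p hp) (hlenQ s hs t ht), Finset.sum_div]
        refine Finset.sum_congr rfl fun q hq ↦ ?_
        rw [hPex s hs1 p hp q (Finset.mem_range.1 hq), PsdDyadic.getMZ]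
        field_simp
      rw [hmid]
      have hx : ∀ q < nq s, |Q s t q - (((QZ s).getD t []).getD q 0 : ℝ) / 2 ^ cx| ≤ (ρ s : ℝ) / 2 ^ cx :=
        fun q hq ↦ by simpa [PsdDyadic.getMZ] using (hQcl s hs1).out t ht q hq
      refine (CinfExact.abs_sum_mul_sub_le_lin (a := P s p) hx).trans ?_
      have hCabs : ∑ q ∈ range (nq s), |P s p q| ≤ (M s : ℝ) / 2 ^ cC := by
        have e : ∑ q ∈ range (nq s), |P s p q|
            = (∑ q ∈ range (nq s), |(((PZ s).getD p []).getD q 0 : ℝ)|) / 2 ^ cC := by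
          rw [Finset.sum_div]
          refine Finset.sum_congr rfl fun q hq ↦ ?_
          rw [hPex s hs1 p hp q (Finset.mem_range.1 hq), PsdDyadic.getMZ, abs_div, abs_of_pos h2C]
        rw [e]; exact div_le_div_of_nonneg_right (hMP s hs1 p hp) h2C.le
      calc (ρ s : ℝ) / 2 ^ cx * ∑ q ∈ range (nq s), |P s p q|
          ≤ (ρ s : ℝ) / 2 ^ cx * ((M s : ℝ) / 2 ^ cC) := by gcongr
        _ = (ρ s : ℝ) * M s / (2 ^ cC * 2 ^ cx) := by field_simp
    · -- P claimed, Q exact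
      have hs1' : K₁ ≤ s := by omega
      have hmid : (CinfExact.dotZ2 ((PZ s).getD p []) ((QZ s).getD t []) : ℝ) / (2 ^ cC * 2 ^ cx)
          = ∑ q ∈ range (nq s), ((((PZ s).getD p []).getD q 0 : ℝ) / 2 ^ cx) * Q s t q := by
        rw [CinfExact.dotZ2_eq_sum _ _ (nq s) (hlenP s hs p hp) (hlenQ s hs t ht), Finset.sum_div]
        refine Finset.sum_congr rfl fun q hq ↦ ?_
        rw [hQex s hs1' hs t ht q (Finset.mem_range.1 hq), PsdDyadic.getMZ]
        field_simp
      rw [hmid]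
      have hx : ∀ q < nq s, |P s p q - (((PZ s).getD p []).getD q 0 : ℝ) / 2 ^ cx| ≤ (ρ s : ℝ) / 2 ^ cx :=
        fun q hq ↦ by simpa [PsdDyadic.getMZ] using (hPcl s hs1' hs).out p hp q hq
      refine (CinfExact.abs_sum_mul_sub_le_exact_right (y := Q s t) hx).trans ?_
      have hCabs : ∑ q ∈ range (nq s), |Q s t q| ≤ (M s : ℝ) / 2 ^ cC := by
        have e : ∑ q ∈ range (nq s), |Q s t q|
            = (∑ q ∈ range (nq s), |(((QZ s).getD t []).getD q 0 : ℝ)|) / 2 ^ cC := by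
          rw [Finset.sum_div]
          refine Finset.sum_congr rfl fun q hq ↦ ?_
          rw [hQex s hs1' hs t ht q (Finset.mem_range.1 hq), PsdDyadic.getMZ, abs_div, abs_of_pos h2C]
        rw [e]; exact div_le_div_of_nonneg_right (hMQ s hs1' hs t ht) h2C.le
      calc (ρ s : ℝ) / 2 ^ cx * ∑ q ∈ range (nq s), |Q s t q|
          ≤ (ρ s : ℝ) / 2 ^ cx * ((M s : ℝ) / 2 ^ cC) := by gcongr
        _ = (ρ s : ℝ) * M s / (2 ^ cC * 2 ^ cx) := by field_simp
  -- sum over the pairs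
  have hsum : |LgenR P Q K nq p t - (sumPairs PZ QZ p t K : ℝ) / (2 ^ cC * 2 ^ cx)|
      ≤ (∑ s ∈ range K, (ρ s : ℝ) * M s) / (2 ^ cC * 2 ^ cx) := by
    rw [LgenR, sumPairs_eq, Finset.sum_div, ← Finset.sum_sub_distrib, Finset.sum_div]
    exact (Finset.abs_sum_le_sum_abs _ _).trans (Finset.sum_le_sum fun s hs ↦ hpair s (Finset.mem_range.1 hs))
  -- the rounding enclosure of the claim
  have hround := hrows.out p hp t ht
  have hrow : ((rowL PZ QZ K W p).getD t 0 : ℝ) = (sumPairs PZ QZ p t K : ℝ) := by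
    rw [rowL, List.getD_eq_getElem?_getD, List.getElem?_map, List.getElem?_range ht]; rfl
  have hround' : |(sumPairs PZ QZ p t K : ℝ) - (PsdDyadic.getMZ OZ p t : ℝ) * 2 ^ k| ≤ 2 ^ k := by
    rw [← hrow]; exact_mod_cast hround
  have step2 : |(sumPairs PZ QZ p t K : ℝ) / (2 ^ cC * 2 ^ cx) - (PsdDyadic.getMZ OZ p t : ℝ) / 2 ^ cO|
      ≤ (2 : ℝ) ^ k / (2 ^ cC * 2 ^ cx) := by
    have e : (sumPairs PZ QZ p t K : ℝ) / (2 ^ cC * 2 ^ cx) - (PsdDyadic.getMZ OZ p t : ℝ) / 2 ^ cO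
        = ((sumPairs PZ QZ p t K : ℝ) - (PsdDyadic.getMZ OZ p t : ℝ) * 2 ^ k) / (2 ^ cC * 2 ^ cx) := by
      rw [← hpow]; field_simp
    rw [e, abs_div, abs_of_pos (by positivity : (0 : ℝ) < 2 ^ cC * 2 ^ cx)]
    exact div_le_div_of_nonneg_right hround' (by positivity)
  have hfin : (∑ s ∈ range K, (ρ s : ℝ) * M s) / (2 ^ cC * 2 ^ cx) + (2 : ℝ) ^ k / (2 ^ cC * 2 ^ cx)
      ≤ (ρO : ℝ) / 2 ^ cO := by
    rw [← add_div, div_le_div_iff₀ (by positivity) h2O]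
    calc (∑ s ∈ range K, (ρ s : ℝ) * M s + (2 : ℝ) ^ k) * 2 ^ cO ≤ (ρO : ℝ) * 2 ^ k * 2 ^ cO := by gcongr
      _ = (ρO : ℝ) * (2 ^ cC * 2 ^ cx) := by rw [← hpow]; ring
  calc |LgenR P Q K nq p t - (PsdDyadic.getMZ OZ p t : ℝ) / 2 ^ cO|
      ≤ |LgenR P Q K nq p t - (sumPairs PZ QZ p t K : ℝ) / (2 ^ cC * 2 ^ cx)|
        + |(sumPairs PZ QZ p t K : ℝ) / (2 ^ cC * 2 ^ cx) - (PsdDyadic.getMZ OZ p t : ℝ) / 2 ^ cO| :=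
        abs_sub_le _ _ _
    _ ≤ _ := add_le_add hsum step2
    _ ≤ (ρO : ℝ) / 2 ^ cO := hfin

end CinfStageL

end Summit.RiemannHypothesis.RiemannHypothesis.Theorems.WeilFormatC
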